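import Summits.QuantumAdvantage.AdviceFreeQNC0.BlockLemma
import HarnessLib

/-!
# Cell qa-qnc0, `p = 3` — the register chain: GENERAL site operators, chains and the PATH-SUM IDENTITY
(prover qn-prover-3 g22; the bookkeeping half of `twistBoundX3Local_of`, planner qa-qnc0-p1 g20 `exp20/Sketch20x.lean` §7)

The block lemma `blockOpR_contracts` (`BlockLemma.lean`) and the site contraction `rnsq_siteOpR_le` (`BondTwistLocal.lean`) are
the two analytic inputs of `BondTwist3.TwistBoundX3Local`; what was missing is the path-sum bookkeeping.  This file supplies the
generic part, for the register chain `RegState r` of `BondTwistLocal.lean`: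

* `genOp w` — the backward site operator with arbitrary complex branch weights `w σ b` (`siteOpR ζ ε` is the case
  `w σ b = (±1)·ζ^{[b]}`, `genOp_sign`); **`rnsq_genOp_le`**: weights of norm `≤ 1` give an `ℓ²`-contraction (same 2-to-1
  re-indexing `sum_nextState` as `rnsq_siteOpR_le`);
* `chainFrom W f i L` — the composition of the site operators of sites `i, …, i+L−1` applied to the final vector `f`;
  `rnsq_chainFrom_le`;
* `traj x σ m` — the state after reading the letters `x 0, …, x (m−1)` from `σ`; `pathW` — the explicit weight of one letter
  string (product of the site weights along the trajectory times the final vector); **`sum_pathW_eq`** — THE PATH-SUM IDENTITY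
  `Σ_{b ∈ {0,1}^L} pathW W f i σ L b = 2^L · chainFrom W f i L σ`;
* `norm_sq_le_rnsq` — one entry is bounded by the `ℓ²` norm.

WHAT THIS IS NOT: no block counting and no strategy here (`RegisterChainBlocks.lean`, `TwistBoundX3LocalProof*.lean`); crux 22907
untouched; separation NOT moved.
-/

noncomputable section

namespace Summit.QuantumAdvantage.AdviceFreeQNC0

open Finset

namespace BondTwist3

variable {r : ℕ}

/-! ## General site operators -/

/-- The backward site operator with complex branch weights `w σ b`: `(T g)(σ) = ½ Σ_b w(σ,b)·g(σ·b)`. -/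
def genOp (w : RegState r → Bool → ℂ) (g : RegState r → ℂ) : RegState r → ℂ :=
  fun σ => (w σ false * g (nextState σ false) + w σ true * g (nextState σ true)) / 2

/-- The sign-and-phase weight `(±1)·ζ^{[b]}` of a sign pattern `ε` and a true-branch phase `ζ`. -/
def signW (ζ : ℂ) (ε : RegState r → Bool → Bool) : RegState r → Bool → ℂ :=
  fun σ b => (if ε σ b then (-1 : ℂ) else 1) * (if b then ζ else 1)

/-- Sign-and-phase weights have norm `≤ 1` when `‖ζ‖ ≤ 1`. -/
theorem norm_signW_le {ζ : ℂ} (hζ : ‖ζ‖ ≤ 1) (ε : RegState r → Bool → Bool) (σ : RegState r) (b : Bool) :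
    ‖signW ζ ε σ b‖ ≤ 1 := by
  unfold signW
  rw [norm_mul, norm_sgn, one_mul]
  cases b
  · simp
  · simpa using hζ

/-- A sign-and-phase weight gives the site operator `siteOpR` of `BondTwistLocal.lean`. -/
theorem genOp_sign (ζ : ℂ) (ε : RegState r → Bool → Bool) (g : RegState r → ℂ) :
    genOp (signW ζ ε) g = siteOpR ζ ε g := by
  funext σ
  unfold genOp signW siteOpR
  simp only [Bool.false_eq_true, if_false, if_true, mul_one]
  ring

/-- `‖(a + b)/2‖² ≤ (‖a‖² + ‖b‖²)/2`. -/
theorem norm_avg_sq_le (a b : ℂ) : ‖(a + b) / 2‖ ^ 2 ≤ (‖a‖ ^ 2 + ‖b‖ ^ 2) / 2 := by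
  have h := norm_avg_sq_add a b
  nlinarith [sq_nonneg ‖a - b‖]

/-- **Every general site operator with weights of norm `≤ 1` is an `ℓ²`-contraction.** -/
theorem rnsq_genOp_le (w : RegState r → Bool → ℂ) (hw : ∀ σ b, ‖w σ b‖ ≤ 1) (g : RegState r → ℂ) :
    rnsq (genOp w g) ≤ rnsq g := by
  unfold rnsq
  have hpt : ∀ σ : RegState r, ‖genOp w g σ‖ ^ 2 ≤
      (‖g (nextState σ false)‖ ^ 2 + ‖g (nextState σ true)‖ ^ 2) / 2 := by
    intro σ
    unfold genOp
    refine (norm_avg_sq_le _ _).trans ?_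
    have h0 : ‖w σ false * g (nextState σ false)‖ ≤ ‖g (nextState σ false)‖ := by
      rw [norm_mul]; exact mul_le_of_le_one_left (norm_nonneg _) (hw σ false)
    have h1 : ‖w σ true * g (nextState σ true)‖ ≤ ‖g (nextState σ true)‖ := by
      rw [norm_mul]; exact mul_le_of_le_one_left (norm_nonneg _) (hw σ true)
    have h0' := pow_le_pow_left₀ (norm_nonneg _) h0 2
    have h1' := pow_le_pow_left₀ (norm_nonneg _) h1 2
    linarith
  calc ∑ σ, ‖genOp w g σ‖ ^ 2 ≤ ∑ σ, (‖g (nextState σ false)‖ ^ 2 + ‖g (nextState σ true)‖ ^ 2) / 2 :=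
        sum_le_sum fun σ _ => hpt σ
    _ = ∑ τ, ‖g τ‖ ^ 2 := by
        rw [← sum_div, sum_nextState (fun τ => ‖g τ‖ ^ 2)]; ring

/-- One entry is bounded by the `ℓ²` norm: `‖g σ‖² ≤ rnsq g`. -/
theorem norm_sq_le_rnsq (g : RegState r → ℂ) (σ : RegState r) : ‖g σ‖ ^ 2 ≤ rnsq g := by
  unfold rnsq
  exact Finset.single_le_sum (f := fun τ => ‖g τ‖ ^ 2) (fun τ _ => by positivity) (mem_univ σ)

/-- `rnsq` of a pointwise bounded vector: `|g| ≤ 1 ⇒ rnsq g ≤ #RegState r = 6·4^r`. -/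
theorem rnsq_le_card (g : RegState r → ℂ) (hg : ∀ σ, ‖g σ‖ ≤ 1) :
    rnsq g ≤ Fintype.card (RegState r) := by
  unfold rnsq
  calc ∑ σ, ‖g σ‖ ^ 2 ≤ ∑ _σ : RegState r, (1 : ℝ) := sum_le_sum fun σ _ => by
          have := hg σ; nlinarith [norm_nonneg (g σ)]
    _ = Fintype.card (RegState r) := by simp

/-- `#RegState r = 6 · 4^r`. -/
theorem card_regState : Fintype.card (RegState r) = 6 * 4 ^ r := by
  rw [Fintype.card_prod, Fintype.card_prod, ZMod.card, Fintype.card_bool, Fintype.card_fun, Fintype.card_bool,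
    Fintype.card_fin, pow_mul]
  norm_num
  ring

/-! ## Chains of general site operators -/

/-- The chain of general site operators over the sites `i, i+1, …, i+L−1` with site weights `W j`, applied to the final
vector `f`: `chainFrom W f i L = T_i (T_{i+1} (⋯ (T_{i+L−1} f)))`. -/
def chainFrom (W : ℕ → RegState r → Bool → ℂ) (f : RegState r → ℂ) : ℕ → ℕ → RegState r → ℂ
  | _, 0 => f
  | i, L + 1 => genOp (W i) (chainFrom W f (i + 1) L)

/-- Unfolding: no site. -/
@[simp] theorem chainFrom_zero (W : ℕ → RegState r → Bool → ℂ) (f : RegState r → ℂ) (i : ℕ) :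
    chainFrom W f i 0 = f := rfl

/-- Unfolding: the first site. -/
theorem chainFrom_succ (W : ℕ → RegState r → Bool → ℂ) (f : RegState r → ℂ) (i L : ℕ) :
    chainFrom W f i (L + 1) = genOp (W i) (chainFrom W f (i + 1) L) := rfl

/-- A chain of contractions is a contraction. -/
theorem rnsq_chainFrom_le (W : ℕ → RegState r → Bool → ℂ) (hW : ∀ j σ b, ‖W j σ b‖ ≤ 1) (f : RegState r → ℂ) :
    ∀ L i : ℕ, rnsq (chainFrom W f i L) ≤ rnsq f
  | 0, _ => le_rfl
  | L + 1, i => by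
    rw [chainFrom_succ]
    exact (rnsq_genOp_le (W i) (hW i) _).trans (rnsq_chainFrom_le W hW f L (i + 1))

/-! ## Trajectories and the path-sum identity -/

/-- The letters of a finite string, `false` beyond its length. -/
def extB {L : ℕ} (b : Fin L → Bool) (m : ℕ) : Bool := if h : m < L then b ⟨m, h⟩ else false

/-- First letter of a `cons`. -/
theorem extB_cons_zero {L : ℕ} (c : Bool) (b : Fin L → Bool) :
    extB (Fin.cons c b : Fin (L + 1) → Bool) 0 = c := by
  simp [extB]

/-- Later letters of a `cons`. -/
theorem extB_cons_succ {L : ℕ} (c : Bool) (b : Fin L → Bool) (m : ℕ) :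
    extB (Fin.cons c b : Fin (L + 1) → Bool) (m + 1) = extB b m := by
  unfold extB
  by_cases h : m < L
  · rw [dif_pos (by omega), dif_pos h]
    exact Fin.cons_succ (α := fun _ => Bool) c b ⟨m, h⟩
  · rw [dif_neg (by omega), dif_neg h]

/-- The state after reading the letters `x 0, …, x (m−1)` from `σ`. -/
def traj (x : ℕ → Bool) (σ : RegState r) : ℕ → RegState r
  | 0 => σ
  | m + 1 => nextState (traj x σ m) (x m)

/-- Unfolding. -/
@[simp] theorem traj_zero (x : ℕ → Bool) (σ : RegState r) : traj x σ 0 = σ := rfl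

/-- Unfolding. -/
theorem traj_succ (x : ℕ → Bool) (σ : RegState r) (m : ℕ) : traj x σ (m + 1) = nextState (traj x σ m) (x m) := rfl

/-- Shift: the trajectory after the first letter is the trajectory of the shifted stream from `σ·(x 0)`. -/
theorem traj_succ_shift (x : ℕ → Bool) (σ : RegState r) :
    ∀ m : ℕ, traj x σ (m + 1) = traj (fun j => x (j + 1)) (nextState σ (x 0)) m
  | 0 => rfl
  | m + 1 => by rw [traj_succ, traj_succ_shift x σ m]; rfl

/-- The explicit weight of one letter stream: the product of the site weights along the trajectory (sites `i, …, i+L−1`)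
times the final vector at the end state. -/
def pathW (W : ℕ → RegState r → Bool → ℂ) (f : RegState r → ℂ) (i : ℕ) (σ : RegState r) (L : ℕ) (x : ℕ → Bool) : ℂ :=
  (∏ m ∈ range L, W (i + m) (traj x σ m) (x m)) * f (traj x σ L)

/-- Peeling the first letter off the path weight. -/
theorem pathW_succ (W : ℕ → RegState r → Bool → ℂ) (f : RegState r → ℂ) (i : ℕ) (σ : RegState r) (L : ℕ)
    (x : ℕ → Bool) :
    pathW W f i σ (L + 1) x = W i σ (x 0) * pathW W f (i + 1) (nextState σ (x 0)) L (fun j => x (j + 1)) := by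
  unfold pathW
  rw [Finset.prod_range_succ' (fun m => W (i + m) (traj x σ m) (x m))]
  simp only [traj_succ_shift, add_zero, traj_zero]
  have h : ∀ m ∈ range L, W (i + (m + 1)) (traj (fun j => x (j + 1)) (nextState σ (x 0)) m) (x (m + 1)) =
      W (i + 1 + m) (traj (fun j => x (j + 1)) (nextState σ (x 0)) m) (x (m + 1)) := by
    intro m _; rw [show i + (m + 1) = i + 1 + m by omega]
  rw [Finset.prod_congr rfl h]
  ring

/-- **THE PATH-SUM IDENTITY**: summing the explicit weights over all letter strings of length `L` gives `2^L` times the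
chain of site operators applied to the final vector, evaluated at the start state. -/
theorem sum_pathW_eq (W : ℕ → RegState r → Bool → ℂ) (f : RegState r → ℂ) :
    ∀ (L i : ℕ) (σ : RegState r), ∑ b : Fin L → Bool, pathW W f i σ L (extB b) = 2 ^ L * chainFrom W f i L σ
  | 0, i, σ => by
    rw [Fintype.sum_subsingleton _ (fun j => Fin.elim0 j)]
    simp [pathW, chainFrom]
  | L + 1, i, σ => by
    have hsplit : ∑ b : Fin (L + 1) → Bool, pathW W f i σ (L + 1) (extB b) =
        ∑ c : Bool, ∑ b : Fin L → Bool, pathW W f i σ (L + 1) (extB (Fin.cons c b : Fin (L + 1) → Bool)) := by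
      rw [← Fintype.sum_prod_type']
      exact (Fintype.sum_equiv (Fin.consEquiv fun _ => Bool) _ _ fun p => rfl).symm
    rw [hsplit]
    have hcons : ∀ (c : Bool) (b : Fin L → Bool),
        pathW W f i σ (L + 1) (extB (Fin.cons c b : Fin (L + 1) → Bool)) =
          W i σ c * pathW W f (i + 1) (nextState σ c) L (extB b) := by
      intro c b
      rw [pathW_succ, extB_cons_zero]
      have e : (fun j => extB (Fin.cons c b : Fin (L + 1) → Bool) (j + 1)) = extB b := funext (extB_cons_succ c b)
      rw [e]
    simp only [hcons, ← Finset.mul_sum, sum_pathW_eq W f L (i + 1)]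
    rw [Fintype.sum_bool, chainFrom_succ]
    unfold genOp
    ring

end BondTwist3

end Summit.QuantumAdvantage.AdviceFreeQNC0

end
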